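import Summits.Ventures.PercRepro.S1SpreadSlackZeroThree
import Summits.Ventures.PercRepro.S1SpreadSlackZeroFour

/-!
# PercRepro — THE SLACK-ZERO STRUCTURE THEOREM: ON A SPREAD E-FREE CORE WHOSE TRIANGLES EXHAUST THE NULLITY, EVERY
`4`-CIRCUIT IS THE SYMMETRIC DIFFERENCE OF TWO TRIANGLES SHARING A POINT, AND `s₄ ≤ s₃` (p1, gen 36)

`proofs/P1-S2-CORANK6.md` §4u. Let `M` be a spread e-free core of nullity `d ≥ 5` with exactly `d` triangles (the triangle
cap `s₃ ≤ d` of §4r is attained — the row `t = d` of the spread case). Every triangle has a private point (regime B is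
automatic with `≥ 5` triangles); for a `4`-circuit `C` let `S₀` be the triangles whose private point lies in `C`. THE BUDGET
(`ncard_union_filter_le_eRk_add_card`): `C ∪ ⋃ S₀` has nullity `≤ #S₀`, because the other `d − #S₀` private points lie
outside it. THE CHAIN (`nullity_step`): `#S₀ ≥ 2`, and the cases `#S₀ = 3, 4` are impossible (Parts B, C), while `#S₀ = 2`
gives `C = (T₁ ∪ T₂) ∖ (T₁ ∩ T₂)` with `T₁ ∩ T₂` a point (Part A). **`fourCircuit_structure_of_triangles_eq_nullity`**.
COUNTING: each private point lies in at most two `4`-circuits (the partner triangle determines the circuit, and a triangle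
meets at most two others, `ncard_triangles_meeting_le_two`), every `4`-circuit carries exactly two private points, so
`2·s₄ ≤ 2·d`: **`ncard_fourCircuits_le_of_triangles_eq_nullity`**: `s₄ ≤ d`. On the cell `(12, 7)` (`n = 19`) the row
`t = 7` of the spread case thus has `s₄ ≤ 7` against the chain's `34` (p7's gen-17 row machinery: `1.042 → 0.857`).
Nothing about any cell is claimed. Axioms: standard.
-/

open scoped Matroid

namespace PercRepro

namespace S1

open Set

variable {α : Type}

open scoped Classical in
/-- **The structure lemma with an explicit private-point choice**: `𝒯` the finset of all triangles (`d` of them, `d ≥ 5`),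
`priv` a private-point choice; for a `4`-circuit `C` the triangles whose private point lies in `C` are exactly two, `T₁ ≠ T₂`,
they share exactly one point, and `C = (T₁ ∪ T₂) ∖ (T₁ ∩ T₂)`. -/
theorem fourCircuit_structure_of_priv (M : Matroid α) [M.Finite]
    (hC1 : ∀ L ⊆ M.E, M.eRk L = 2 → L.ncard ≤ 3)
    (h9 : ∀ X ⊆ M.E, X.ncard ≤ 9 → X.encard ≤ M.eRk X + 3)
    (hno : ¬ ∃ W ⊆ M.E, W.ncard = 6 ∧ M.eRk W ≤ 3)
    {d : ℕ} (hd : M.E.encard = M.eRank + d)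
    (𝒯 : Finset (Set α)) (h𝒯 : ∀ T ∈ 𝒯, M.IsCircuit T ∧ T.ncard = 3) (ht : 𝒯.card = d)
    (priv : Set α → α) (hpT : ∀ T ∈ 𝒯, priv T ∈ T) (hpN : ∀ T ∈ 𝒯, ∀ T' ∈ 𝒯, T' ≠ T → priv T ∉ T')
    {C : Set α} (hC : M.IsCircuit C) (hC4 : C.ncard = 4) :
    ∃ T₁ T₂ : Set α, T₁ ∈ 𝒯 ∧ T₂ ∈ 𝒯 ∧ T₁ ≠ T₂ ∧ 𝒯.filter (fun T => priv T ∈ C) = {T₁, T₂} ∧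
      (T₁ ∩ T₂).ncard = 1 ∧ C = (T₁ ∪ T₂) \ (T₁ ∩ T₂) := by
  have hCfin : C.Finite := M.ground_finite.subset hC.subset_ground
  set S₀ := 𝒯.filter (fun T => priv T ∈ C) with hS₀
  have hbud := ncard_union_filter_le_eRk_add_card M hd 𝒯 (fun T hT => (h𝒯 T hT).1) ht priv hpT hpN hC.subset_ground
  rw [← hS₀] at hbud
  have hS₀sub : ∀ T ∈ S₀, T ∈ 𝒯 ∧ priv T ∈ C := fun T hT => Finset.mem_filter.1 hT
  -- `priv` is injective on `𝒯`, so `#S₀ ≤ |C| = 4`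
  have hinj : Set.InjOn priv (𝒯 : Set (Set α)) := by
    intro T hT T' hT' h
    by_contra hne
    exact hpN T hT T' hT' (Ne.symm hne) (h ▸ hpT T' hT')
  have hs4 : S₀.card ≤ 4 := by
    have himg : S₀.image priv ⊆ hCfin.toFinset := by
      intro p hp
      obtain ⟨T, hT, rfl⟩ := Finset.mem_image.1 hp
      exact (Set.Finite.mem_toFinset hCfin).2 (hS₀sub T hT).2
    have h1 := Finset.card_le_card himg
    rw [Finset.card_image_of_injOn (hinj.mono (fun T hT => (hS₀sub T hT).1)), ← Set.ncard_eq_toFinset_card C hCfin,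
      hC4] at h1
    exact h1
  have hdistinct : ∀ T ∈ S₀, ∀ T' ∈ S₀, T ≠ T' → priv T ≠ priv T' := fun T hT T' hT' hne h =>
    hne (hinj (hS₀sub T hT).1 (hS₀sub T' hT').1 h)
  -- the trace of a triangle of `S₀` on `C` avoids the other private points
  have htrace : ∀ T ∈ S₀, ∀ T' ∈ S₀, T' ≠ T → priv T' ∉ T := fun T hT T' hT' hne =>
    hpN T' (hS₀sub T' hT').1 T (hS₀sub T hT).1 (Ne.symm hne)
  -- the cases on `#S₀`
  have hs2 : 2 ≤ S₀.card := by
    by_contra hlt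
    push Not at hlt
    interval_cases h : S₀.card
    · -- `S₀ = ∅`: `|C| ≤ rk C`
      have hempty : S₀ = ∅ := Finset.card_eq_zero.1 h
      have hU : (⋃ T ∈ (∅ : Finset (Set α)), T) = (∅ : Set α) := by simp
      rw [hempty, hU, union_empty, hC4, eRk_toNat_eq_three_of_four M hC hC4] at hbud
      omega
    · -- `S₀ = {T}`: one nullity step already exceeds the budget `1`
      obtain ⟨T, hT⟩ := Finset.card_eq_one.1 h
      have hTS : T ∈ S₀ := by rw [hT]; exact Finset.mem_singleton_self T
      obtain ⟨hT𝒯, _⟩ := hS₀sub T hTS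
      rw [hT, Finset.set_biUnion_singleton] at hbud
      have hstep := nullity_step M hC.subset_ground (h𝒯 T hT𝒯).1 (tri_not_subset_four M hC hC4 (h𝒯 T hT𝒯).1 (h𝒯 T hT𝒯).2)
      rw [hC4, eRk_toNat_eq_three_of_four M hC hC4] at hstep
      omega
  have hcases : S₀.card = 2 ∨ S₀.card = 3 ∨ S₀.card = 4 := by omega
  rcases hcases with h2 | h3 | h4
  · -- `s = 2`
    obtain ⟨T₁, T₂, h12, hS⟩ := Finset.card_eq_two.1 h2
    have hT₁S : T₁ ∈ S₀ := by rw [hS]; exact Finset.mem_insert_self _ _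
    have hT₂S : T₂ ∈ S₀ := by rw [hS]; exact Finset.mem_insert_of_mem (Finset.mem_singleton_self _)
    obtain ⟨hT₁𝒯, _⟩ := hS₀sub T₁ hT₁S
    obtain ⟨hT₂𝒯, _⟩ := hS₀sub T₂ hT₂S
    have hbud' : (C ∪ T₁ ∪ T₂).ncard ≤ (M.eRk (C ∪ T₁ ∪ T₂)).toNat + 2 := by
      rw [hS, Finset.set_biUnion_insert, Finset.set_biUnion_singleton, Finset.card_pair h12, ← union_assoc] at hbud
      exact hbud
    obtain ⟨hCeq, hI⟩ := eq_sdiff_inter_of_two M hC1 hC hC4 (h𝒯 T₁ hT₁𝒯).1 (h𝒯 T₁ hT₁𝒯).2 (h𝒯 T₂ hT₂𝒯).1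
      (h𝒯 T₂ hT₂𝒯).2 h12 hbud'
    exact ⟨T₁, T₂, hT₁𝒯, hT₂𝒯, h12, hS, hI, hCeq⟩
  · -- `s = 3`: impossible
    exfalso
    obtain ⟨T₁, T₂, T₃, h12, h13, h23, hS⟩ := Finset.card_eq_three.1 h3
    have hT₁S : T₁ ∈ S₀ := by rw [hS]; exact Finset.mem_insert_self _ _
    have hT₂S : T₂ ∈ S₀ := by rw [hS]; exact Finset.mem_insert_of_mem (Finset.mem_insert_self _ _)
    have hT₃S : T₃ ∈ S₀ := by
      rw [hS]; exact Finset.mem_insert_of_mem (Finset.mem_insert_of_mem (Finset.mem_singleton_self _))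
    obtain ⟨hT₁𝒯, hp₁C⟩ := hS₀sub T₁ hT₁S
    obtain ⟨hT₂𝒯, hp₂C⟩ := hS₀sub T₂ hT₂S
    obtain ⟨hT₃𝒯, hp₃C⟩ := hS₀sub T₃ hT₃S
    have hbud' : (C ∪ T₁ ∪ T₂ ∪ T₃).ncard ≤ (M.eRk (C ∪ T₁ ∪ T₂ ∪ T₃)).toNat + 3 := by
      rw [hS, Finset.set_biUnion_insert, Finset.set_biUnion_insert, Finset.set_biUnion_singleton,
        Finset.card_insert_of_notMem (by simp only [Finset.mem_insert, Finset.mem_singleton, not_or]; exact ⟨h12, h13⟩),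
        Finset.card_pair h23] at hbud
      rw [show C ∪ T₁ ∪ T₂ ∪ T₃ = C ∪ (T₁ ∪ (T₂ ∪ T₃)) by ac_rfl]
      exact hbud
    -- the fourth point `u` of `C`
    have hp12 : priv T₁ ≠ priv T₂ := hdistinct T₁ hT₁S T₂ hT₂S h12
    have hp13 : priv T₁ ≠ priv T₃ := hdistinct T₁ hT₁S T₃ hT₃S h13
    have hp23 : priv T₂ ≠ priv T₃ := hdistinct T₂ hT₂S T₃ hT₃S h23
    obtain ⟨u, huC, hu⟩ : ∃ u ∈ C, u ∉ ({priv T₁, priv T₂, priv T₃} : Set α) := by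
      by_contra hcon
      push Not at hcon
      have := Set.ncard_le_ncard (fun x hx => hcon x hx : C ⊆ {priv T₁, priv T₂, priv T₃}) (toFinite _)
      rw [hC4, Set.ncard_insert_of_notMem (by simp only [mem_insert_iff, mem_singleton_iff, not_or]; exact ⟨hp12, hp13⟩)
        (toFinite _), Set.ncard_pair hp23] at this
      omega
    simp only [mem_insert_iff, mem_singleton_iff, not_or] at hu
    have hCeq : C = {priv T₁, priv T₂, priv T₃, u} := by
      symm
      apply Set.eq_of_subset_of_ncard_le _ _ hCfin
      · intro x hx
        rcases hx with rfl | rfl | rfl | rfl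
        · exact hp₁C
        · exact hp₂C
        · exact hp₃C
        · exact huC
      · rw [hC4, Set.ncard_insert_of_notMem (by
          simp only [mem_insert_iff, mem_singleton_iff, not_or]; exact ⟨hp12, hp13, fun h => hu.1 h.symm⟩) (toFinite _),
          Set.ncard_insert_of_notMem (by
          simp only [mem_insert_iff, mem_singleton_iff, not_or]; exact ⟨hp23, fun h => hu.2.1 h.symm⟩) (toFinite _),
          Set.ncard_pair (fun h => hu.2.2 h.symm)]
    have htr₁ : T₁ ∩ C ⊆ {priv T₁, u} := by
      intro x hx
      rw [hCeq] at hx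
      rcases hx.2 with rfl | rfl | rfl | rfl
      · exact Or.inl rfl
      · exact absurd hx.1 (htrace T₁ hT₁S T₂ hT₂S (Ne.symm h12))
      · exact absurd hx.1 (htrace T₁ hT₁S T₃ hT₃S (Ne.symm h13))
      · exact Or.inr rfl
    have htr₂ : T₂ ∩ C ⊆ {priv T₂, u} := by
      intro x hx
      rw [hCeq] at hx
      rcases hx.2 with rfl | rfl | rfl | rfl
      · exact absurd hx.1 (htrace T₂ hT₂S T₁ hT₁S h12)
      · exact Or.inl rfl
      · exact absurd hx.1 (htrace T₂ hT₂S T₃ hT₃S (Ne.symm h23))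
      · exact Or.inr rfl
    have htr₃ : T₃ ∩ C ⊆ {priv T₃, u} := by
      intro x hx
      rw [hCeq] at hx
      rcases hx.2 with rfl | rfl | rfl | rfl
      · exact absurd hx.1 (htrace T₃ hT₃S T₁ hT₁S h13)
      · exact absurd hx.1 (htrace T₃ hT₃S T₂ hT₂S h23)
      · exact Or.inl rfl
      · exact Or.inr rfl
    exact not_three_private M hC1 hno hC hC4 (h𝒯 T₁ hT₁𝒯).1 (h𝒯 T₁ hT₁𝒯).2 (h𝒯 T₂ hT₂𝒯).1 (h𝒯 T₂ hT₂𝒯).2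
      (h𝒯 T₃ hT₃𝒯).1 (h𝒯 T₃ hT₃𝒯).2 h12 h13 h23 (hpT T₁ hT₁𝒯) hp₁C (hpT T₂ hT₂𝒯) hp₂C (hpT T₃ hT₃𝒯) hp₃C huC
      (fun h => hu.1 h.symm) (fun h => hu.2.1 h.symm) (fun h => hu.2.2 h.symm) htr₁ htr₂ htr₃ hbud'
  · -- `s = 4`: impossible
    exfalso
    obtain ⟨T₁, T₂, T₃, T₄, hT₁S, hT₂S, hT₃S, hT₄S, h12, h13, h14, h23, h24, h34⟩ :=
      Finset.three_lt_card_iff.1 (by omega : 3 < S₀.card)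
    have hS : S₀ = {T₁, T₂, T₃, T₄} := by
      symm
      apply Finset.eq_of_subset_of_card_le
      · intro T hT
        simp only [Finset.mem_insert, Finset.mem_singleton] at hT
        rcases hT with rfl | rfl | rfl | rfl <;> assumption
      · rw [h4, Finset.card_insert_of_notMem (by
          simp only [Finset.mem_insert, Finset.mem_singleton, not_or]; exact ⟨h12, h13, h14⟩),
          Finset.card_insert_of_notMem (by
          simp only [Finset.mem_insert, Finset.mem_singleton, not_or]; exact ⟨h23, h24⟩), Finset.card_pair h34]
    obtain ⟨hT₁𝒯, hp₁C⟩ := hS₀sub T₁ hT₁S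
    obtain ⟨hT₂𝒯, hp₂C⟩ := hS₀sub T₂ hT₂S
    obtain ⟨hT₃𝒯, hp₃C⟩ := hS₀sub T₃ hT₃S
    obtain ⟨hT₄𝒯, hp₄C⟩ := hS₀sub T₄ hT₄S
    have hbud' : (C ∪ T₁ ∪ T₂ ∪ T₃ ∪ T₄).ncard ≤ (M.eRk (C ∪ T₁ ∪ T₂ ∪ T₃ ∪ T₄)).toNat + 4 := by
      rw [h4, hS, Finset.set_biUnion_insert, Finset.set_biUnion_insert, Finset.set_biUnion_insert,
        Finset.set_biUnion_singleton] at hbud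
      rw [show C ∪ T₁ ∪ T₂ ∪ T₃ ∪ T₄ = C ∪ (T₁ ∪ (T₂ ∪ (T₃ ∪ T₄))) by ac_rfl]
      exact hbud
    have hp12 : priv T₁ ≠ priv T₂ := hdistinct T₁ hT₁S T₂ hT₂S h12
    have hp13 : priv T₁ ≠ priv T₃ := hdistinct T₁ hT₁S T₃ hT₃S h13
    have hp14 : priv T₁ ≠ priv T₄ := hdistinct T₁ hT₁S T₄ hT₄S h14
    have hp23 : priv T₂ ≠ priv T₃ := hdistinct T₂ hT₂S T₃ hT₃S h23
    have hp24 : priv T₂ ≠ priv T₄ := hdistinct T₂ hT₂S T₄ hT₄S h24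
    have hp34 : priv T₃ ≠ priv T₄ := hdistinct T₃ hT₃S T₄ hT₄S h34
    have hCeq : C = {priv T₁, priv T₂, priv T₃, priv T₄} := by
      symm
      apply Set.eq_of_subset_of_ncard_le _ _ hCfin
      · intro x hx
        rcases hx with rfl | rfl | rfl | rfl
        · exact hp₁C
        · exact hp₂C
        · exact hp₃C
        · exact hp₄C
      · rw [hC4, Set.ncard_insert_of_notMem (by
          simp only [mem_insert_iff, mem_singleton_iff, not_or]; exact ⟨hp12, hp13, hp14⟩) (toFinite _),
          Set.ncard_insert_of_notMem (by
          simp only [mem_insert_iff, mem_singleton_iff, not_or]; exact ⟨hp23, hp24⟩) (toFinite _),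
          Set.ncard_pair hp34]
    have htr : ∀ T ∈ S₀, T ∩ C ⊆ {priv T} := by
      intro T hT x hx
      rw [hCeq] at hx
      rcases hx.2 with rfl | rfl | rfl | rfl
      · by_contra hne; exact htrace T hT T₁ hT₁S (fun h => hne (by rw [h]; rfl)) hx.1
      · by_contra hne; exact htrace T hT T₂ hT₂S (fun h => hne (by rw [h]; rfl)) hx.1
      · by_contra hne; exact htrace T hT T₃ hT₃S (fun h => hne (by rw [h]; rfl)) hx.1
      · by_contra hne; exact htrace T hT T₄ hT₄S (fun h => hne (by rw [h]; rfl)) hx.1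
    exact not_four_private M hC1 h9 hno hC hC4 (h𝒯 T₁ hT₁𝒯).1 (h𝒯 T₁ hT₁𝒯).2 (h𝒯 T₂ hT₂𝒯).1 (h𝒯 T₂ hT₂𝒯).2
      (h𝒯 T₃ hT₃𝒯).1 (h𝒯 T₃ hT₃𝒯).2 (h𝒯 T₄ hT₄𝒯).1 (h𝒯 T₄ hT₄𝒯).2 h12 h13 h14 h23 h24 h34
      (hpT T₁ hT₁𝒯) hp₁C (hpT T₂ hT₂𝒯) hp₂C (hpT T₃ hT₃𝒯) hp₃C (hpT T₄ hT₄𝒯) hp₄C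
      (htr T₁ hT₁S) (htr T₂ hT₂S) (htr T₃ hT₃S) (htr T₄ hT₄S)
      ⟨htrace T₂ hT₂S T₁ hT₁S h12, htrace T₃ hT₃S T₁ hT₁S h13, htrace T₄ hT₄S T₁ hT₁S h14⟩
      ⟨htrace T₁ hT₁S T₂ hT₂S (Ne.symm h12), htrace T₃ hT₃S T₂ hT₂S h23, htrace T₄ hT₄S T₂ hT₂S h24⟩
      ⟨htrace T₁ hT₁S T₃ hT₃S (Ne.symm h13), htrace T₂ hT₂S T₃ hT₃S (Ne.symm h23), htrace T₄ hT₄S T₃ hT₃S h34⟩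
      ⟨htrace T₁ hT₁S T₄ hT₄S (Ne.symm h14), htrace T₂ hT₂S T₄ hT₄S (Ne.symm h24), htrace T₃ hT₃S T₄ hT₄S (Ne.symm h34)⟩
      hbud'

open scoped Classical in
/-- **Each private point lies in at most two `4`-circuits**: a `4`-circuit through `priv T` is `(T ∪ T') ∖ (T ∩ T')` for a
triangle `T'` meeting `T`, the partner determines the circuit, and at most two triangles meet `T`. -/
theorem card_fourCircuits_through_priv_le_two (M : Matroid α) [M.Finite]
    (hC1 : ∀ L ⊆ M.E, M.eRk L = 2 → L.ncard ≤ 3)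
    (h9 : ∀ X ⊆ M.E, X.ncard ≤ 9 → X.encard ≤ M.eRk X + 3)
    (hno : ¬ ∃ W ⊆ M.E, W.ncard = 6 ∧ M.eRk W ≤ 3)
    {d : ℕ} (hd : M.E.encard = M.eRank + d)
    (𝒯 : Finset (Set α)) (h𝒯 : ∀ T ∈ 𝒯, M.IsCircuit T ∧ T.ncard = 3)
    (hall : ∀ T, M.IsCircuit T → T.ncard = 3 → T ∈ 𝒯) (ht : 𝒯.card = d)
    (priv : Set α → α) (hpT : ∀ T ∈ 𝒯, priv T ∈ T) (hpN : ∀ T ∈ 𝒯, ∀ T' ∈ 𝒯, T' ≠ T → priv T ∉ T')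
    (𝒞 : Finset (Set α)) (h𝒞 : ∀ C ∈ 𝒞, M.IsCircuit C ∧ C.ncard = 4) {T : Set α} (hT : T ∈ 𝒯) :
    (𝒞.filter (fun C => priv T ∈ C)).card ≤ 2 := by
  set 𝒩 := 𝒯.filter (fun T' => T' ≠ T ∧ ¬ Disjoint T' T) with h𝒩
  have h𝒩2 : 𝒩.card ≤ 2 := by
    have hset : (𝒩 : Set (Set α)) = {C : Set α | M.IsCircuit C ∧ C.ncard = 3 ∧ C ≠ T ∧ ¬ Disjoint C T} := by
      ext C
      simp only [h𝒩, Finset.coe_filter, mem_setOf_eq]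
      constructor
      · rintro ⟨hC𝒯, hne, hdis⟩; exact ⟨(h𝒯 C hC𝒯).1, (h𝒯 C hC𝒯).2, hne, hdis⟩
      · rintro ⟨hC, hC3, hne, hdis⟩; exact ⟨hall C hC hC3, hne, hdis⟩
    have := ncard_triangles_meeting_le_two M hC1 h9 hno (h𝒯 T hT).1 (h𝒯 T hT).2
    rw [← hset, Set.ncard_coe_finset] at this
    exact this
  -- the partner map
  let P : Set α → Prop := fun C => ∃ T', T' ∈ 𝒯 ∧ T' ≠ T ∧ (T ∩ T').ncard = 1 ∧ C = (T ∪ T') \ (T ∩ T')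
  let f : Set α → Set α := fun C => if h : P C then Classical.choose h else T
  have hP : ∀ C ∈ 𝒞.filter (fun C => priv T ∈ C), P C := by
    intro C hC
    obtain ⟨hC𝒞, hpC⟩ := Finset.mem_filter.1 hC
    obtain ⟨T₁, T₂, hT₁, hT₂, h12, hS, hI, hCeq⟩ :=
      fourCircuit_structure_of_priv M hC1 h9 hno hd 𝒯 h𝒯 ht priv hpT hpN (h𝒞 C hC𝒞).1 (h𝒞 C hC𝒞).2
    have hTS : T ∈ 𝒯.filter (fun T => priv T ∈ C) := Finset.mem_filter.2 ⟨hT, hpC⟩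
    rw [hS] at hTS
    simp only [Finset.mem_insert, Finset.mem_singleton] at hTS
    rcases hTS with rfl | rfl
    · exact ⟨T₂, hT₂, Ne.symm h12, hI, hCeq⟩
    · refine ⟨T₁, hT₁, h12, ?_, ?_⟩
      · rw [inter_comm]; exact hI
      · rw [union_comm, inter_comm]; exact hCeq
  have hf : ∀ C ∈ 𝒞.filter (fun C => priv T ∈ C),
      f C ∈ 𝒯 ∧ f C ≠ T ∧ (T ∩ f C).ncard = 1 ∧ C = (T ∪ f C) \ (T ∩ f C) := by
    intro C hC
    have h := hP C hC
    simp only [f, dif_pos h]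
    exact Classical.choose_spec h
  have hmaps : Set.MapsTo f (𝒞.filter (fun C => priv T ∈ C) : Set (Set α)) (𝒩 : Set (Set α)) := by
    intro C hC
    obtain ⟨h1, h2, h3, _⟩ := hf C (Finset.mem_coe.1 hC)
    refine Finset.mem_coe.2 (Finset.mem_filter.2 ⟨h1, h2, ?_⟩)
    intro hdis
    have : (T ∩ f C).ncard = 0 := by rw [Set.disjoint_iff_inter_eq_empty.1 hdis.symm]; exact Set.ncard_empty _
    omega
  have hinj : Set.InjOn f (𝒞.filter (fun C => priv T ∈ C) : Set (Set α)) := by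
    intro C₁ hC₁ C₂ hC₂ h
    obtain ⟨_, _, _, e₁⟩ := hf C₁ (Finset.mem_coe.1 hC₁)
    obtain ⟨_, _, _, e₂⟩ := hf C₂ (Finset.mem_coe.1 hC₂)
    rw [e₁, e₂, h]
  exact (Finset.card_le_card_of_injOn f hmaps hinj).trans h𝒩2

/-- **THE SLACK-ZERO CAP: `s₄ ≤ d` on a spread e-free core of nullity `d ≥ 5` with exactly `d` triangles.** Every
`4`-circuit carries exactly two private points of triangles and each private point lies in at most two `4`-circuits. -/
theorem ncard_fourCircuits_le_of_triangles_eq_nullity (M : Matroid α) [M.Finite]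
    (hfree : ∀ e ∈ M.E, ∃ A ⊆ M.E \ {e}, e ∉ M.closure A ∧ e ∉ M.closure ((M.E \ {e}) \ A))
    (hns : ¬ ∃ W ⊆ M.E, W.ncard ≤ 9 ∧ W.encard = M.eRk W + 4) {d : ℕ} (hd : M.E.encard = M.eRank + d)
    (h5 : 5 ≤ d) (ht : {C : Set α | M.IsCircuit C ∧ C.ncard = 3}.ncard = d) :
    {C : Set α | M.IsCircuit C ∧ C.ncard = 4}.ncard ≤ d := by
  classical
  have hC1 := lines_le_three_of_free M hfree
  have h9 := nullity_le_three_of_spread M hns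
  have hno := no_six_of_five_le_triangles M hfree hns (by omega)
  set 𝒯s := {C : Set α | M.IsCircuit C ∧ C.ncard = 3} with h𝒯s
  set 𝒞s := {C : Set α | M.IsCircuit C ∧ C.ncard = 4} with h𝒞s
  have h𝒯fin : 𝒯s.Finite := M.ground_finite.finite_subsets.subset (fun C hC => hC.1.subset_ground)
  have h𝒞fin : 𝒞s.Finite := M.ground_finite.finite_subsets.subset (fun C hC => hC.1.subset_ground)
  set 𝒯 := h𝒯fin.toFinset with h𝒯
  set 𝒞 := h𝒞fin.toFinset with h𝒞
  have h𝒯mem : ∀ T, T ∈ 𝒯 ↔ M.IsCircuit T ∧ T.ncard = 3 := fun T => Set.Finite.mem_toFinset h𝒯fin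
  have h𝒞mem : ∀ C, C ∈ 𝒞 ↔ M.IsCircuit C ∧ C.ncard = 4 := fun C => Set.Finite.mem_toFinset h𝒞fin
  have ht' : 𝒯.card = d := by rw [← Set.ncard_eq_toFinset_card 𝒯s h𝒯fin]; exact ht
  have hc' : 𝒞s.ncard = 𝒞.card := Set.ncard_eq_toFinset_card 𝒞s h𝒞fin
  -- a point of the ground set (for the choice of private points)
  haveI : Nonempty α := by
    obtain ⟨T₀, hT₀⟩ : 𝒯s.Nonempty := Set.nonempty_of_ncard_ne_zero (by omega)
    obtain ⟨x, hx⟩ : T₀.Nonempty := Set.nonempty_of_ncard_ne_zero (by rw [hT₀.2]; omega)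
    exact ⟨x⟩
  have hpriv : ∀ T ∈ 𝒯, ∃ p ∈ T, ∀ T' ∈ 𝒯, T' ≠ T → p ∉ T' := by
    intro T hT
    obtain ⟨p, hp, hp'⟩ := exists_private_of_no_six M hfree hns hno ((h𝒯mem T).1 hT).1 ((h𝒯mem T).1 hT).2
    exact ⟨p, hp, fun T' hT' hne => hp' T' ((h𝒯mem T').1 hT').1 ((h𝒯mem T').1 hT').2 hne⟩
  choose! priv hpT hpN using hpriv
  have h𝒯' : ∀ T ∈ 𝒯, M.IsCircuit T ∧ T.ncard = 3 := fun T hT => (h𝒯mem T).1 hT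
  have hall : ∀ T, M.IsCircuit T → T.ncard = 3 → T ∈ 𝒯 := fun T hT hT3 => (h𝒯mem T).2 ⟨hT, hT3⟩
  have h𝒞' : ∀ C ∈ 𝒞, M.IsCircuit C ∧ C.ncard = 4 := fun C hC => (h𝒞mem C).1 hC
  -- every `4`-circuit carries exactly two private points
  have htwo : ∀ C ∈ 𝒞, (𝒯.filter (fun T => priv T ∈ C)).card = 2 := by
    intro C hC
    obtain ⟨T₁, T₂, _, _, h12, hS, _, _⟩ :=
      fourCircuit_structure_of_priv M hC1 h9 hno hd 𝒯 h𝒯' ht' priv hpT hpN (h𝒞' C hC).1 (h𝒞' C hC).2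
    rw [hS, Finset.card_pair h12]
  -- the double count
  have hsum : ∑ C ∈ 𝒞, (𝒯.filter (fun T => priv T ∈ C)).card = ∑ T ∈ 𝒯, (𝒞.filter (fun C => priv T ∈ C)).card := by
    simp only [Finset.card_filter]
    exact Finset.sum_comm
  have hL : ∑ C ∈ 𝒞, (𝒯.filter (fun T => priv T ∈ C)).card = 𝒞.card * 2 := Finset.sum_const_nat htwo
  have hR : ∑ T ∈ 𝒯, (𝒞.filter (fun C => priv T ∈ C)).card ≤ 𝒯.card * 2 := by
    calc ∑ T ∈ 𝒯, (𝒞.filter (fun C => priv T ∈ C)).card ≤ ∑ T ∈ 𝒯, 2 :=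
          Finset.sum_le_sum (fun T hT =>
            card_fourCircuits_through_priv_le_two M hC1 h9 hno hd 𝒯 h𝒯' hall ht' priv hpT hpN 𝒞 h𝒞' hT)
      _ = 𝒯.card * 2 := by rw [Finset.sum_const, smul_eq_mul]
  rw [hc']
  have : 𝒞.card * 2 ≤ 𝒯.card * 2 := by rw [← hL, hsum]; exact hR
  rw [ht'] at this
  omega

/-- **The row form**: `d ≤ s₃` (hence `s₃ = d` by the triangle cap) gives `s₄ ≤ d`. -/
theorem ncard_fourCircuits_le_of_nullity_le_triangles (M : Matroid α) [M.Finite]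
    (hfree : ∀ e ∈ M.E, ∃ A ⊆ M.E \ {e}, e ∉ M.closure A ∧ e ∉ M.closure ((M.E \ {e}) \ A))
    (hns : ¬ ∃ W ⊆ M.E, W.ncard ≤ 9 ∧ W.encard = M.eRk W + 4) {d : ℕ} (hd : M.E.encard = M.eRank + d)
    (h5 : 5 ≤ d) (ht : d ≤ {C : Set α | M.IsCircuit C ∧ C.ncard = 3}.ncard) :
    {C : Set α | M.IsCircuit C ∧ C.ncard = 4}.ncard ≤ d :=
  ncard_fourCircuits_le_of_triangles_eq_nullity M hfree hns hd h5
    (le_antisymm (ncard_triangles_le_nullity M hfree hns hd (by omega)) ht)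

end S1

end PercRepro
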